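import Summits.AtomisticToContinuum.HydrodynamicLimit.Theses.StiffCollisionalRelaxation

/-!
# Birth skeleton for the crux `EulerRelEntropyDock` (stmt-AtomisticToContinuum-17823)

Route `StiffCollisionalRelaxation` (sub-problem `HydrodynamicLimit`), crux since rev 5 (rank 10,
"THE DOCK"):

  `EulerRelEntropyDock := FastMomentRelaxation → CollisionalTransferLocality →
     AprioriBoundsInBand → RelEntropyStability → SecondLawInProbability → _root_.HydrodynamicLimit`,

and `_root_.HydrodynamicLimit` is the packing-GUARDED sub-problem Statement (`∃ η₀ > 0`
outermost, guard `∀ t ∈ Ico 0 T, ∀ x, ρ t x * σ ^ 3 < η₀` on the classical solution). The crux is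
the route's MACROSCOPIC RELATIVE-ENTROPY BOOKKEEPING: every hypothesis of the deterministic PDE
crux `RelEntropyStability` (Dafermos/DiPerna stability of a classical hs-Euler solution against a
bounded measurable field with small initial relative entropy, approximate global entropy
inequality, exponentially small hot-cell functional and small weak residual against
`Λ = Dη_σ(U_cl)`) must be PRODUCED, on a good event of local-Gibbs probability `→ 1`, for the
mesoscopic block field `Ū_N = (ρ̄, m̄, Ē)` of the hard-sphere trajectory from the four
in-probability cruxes, and the resulting `L¹`-closeness of the block fields must be read out as
the conjunct's `TendstoHydroFieldsAt … t`.

## The line (the route's own two-layer plan for the dock: statics at `t = 0` /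
probabilistic glue along the flow / deterministic readout / smearing)

The route text (TWO-LAYER PLAN) foresaw `EulerRelEntropyDock ⇐ MacroBookkeeping (deterministic
Dafermos bookkeeping) → ProbabilisticGlue (good events + statics lemmas)`, with the statics
supports `MesoscopicLLN`, `TimeZeroThermalFloor`, `HsEntropyUniformlyConvex`, `HsFreeEnergyConvex`,
`AdmissibleKernelsExist` consumed as LEMMAS (crux-only rule: they are not antecedents of the
dock). This skeleton types exactly that cut, in the coordinates of `RelEntropyStability` (the
predicates `FieldRegular`, `InChamber`, `EntropyIneq`, `HotCellBound`, `WeakResidualSmall`,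
`initRelEnt`, `l1Dev` below are VERBATIM its hypotheses (a)–(h) and its conclusion, for a general
field `U : ℝ → 𝕋³ → ℝ × V3 × ℝ`, instantiated at the trajectory block field `Ufl φ (Φ N) z`):

* `stub_admissibleKernels` (S0, construction, S–M): an admissible kernel family exists for every
  `γ ∈ (0, 1/15]` — by name the route's support item `AdmissibleKernelsExist` (stmt-18068); the
  dock must INSTANTIATE the `∀`-kernel cruxes with one family (at `γ = 1/15`), else they are
  consumed vacuously.
* `stub_initialRelEntropy` (S1, statics at `t = 0`, M): under the local Gibbs law, for `σ < σ₀`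
  and a classical solution whose `t = 0` fields are the LLN limit (the conjunct's own hypothesis
  `TendstoHydroFieldsAt … 0`) and whose initial packing fraction is below a threshold `ηi` fixed
  BEFORE the profiles, the initial relative entropy `∫ h(Ū_N(0,x) | U_cl(0,x)) dx` of the block
  field exceeds `δ` with probability `→ 0` — obligation G1 of the 11094 prover verdict
  (`MesoscopicLLN` + `TimeZeroThermalFloor` + the `t = 0` density floor; `L²ₓ` convergence alone
  does not control cold blocks).
* `stub_goodEventLikely` (S2, THE LOAD-BEARING GLUE along the flow, L): from the four
  in-probability antecedents `FastMomentRelaxation → CollisionalTransferLocality →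
  AprioriBoundsInBand → SecondLawInProbability`, with a guard threshold `ηg` fixed BEFORE the
  profiles (`ηg := min(η₁/2, r_an/2)`: `η₁` the uniform dilute threshold of `AprioriBoundsInBand`,
  `r_an` the analyticity radius of `hsExcessFreeEnergy` from the landed `HsEosLowDensity`, so that
  `Λ = Dη_σ(U_cl)` is a smooth space–time test), for every `0 < t < T` and every admissible kernel
  family there are `lam > 0`, `Cexp`, `c₁ > 0` such that for every `δ > 0` the event "the block
  field of the trajectory is NOT a good field at `(t, lam, Cexp, c₁, δ)`" — i.e. one of:
  regularity, chamber `c₁ ≤ ρ̄`, `ρ̄σ³ ≤ 1`, `‖m̄‖² < 2ρ̄Ē` on `[0,t]`, entropy inequality `+δ`,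
  hot-cell bound `Cexp e^{-lam M}` for all `M ≥ 1`, weak residual `≤ δ` against `Λ` fails — has
  local-Gibbs probability `→ 0` (the weak residual splits EXACTLY along the hard-sphere trajectory
  into the kinetic defects `∂Λ_m : D + ∂Λ_E · (Dū + q)`, small by `FastMomentRelaxation` and
  `∫|ū|² ≤ 2E_tot/c₁`, and the two collisional residuals of `CollisionalTransferLocality` tested
  with `ψ = Λ_m`, `χ = Λ_E`; chamber from `AprioriBoundsInBand` (ii); hot cells from the
  exponential moment (i) with `lam = λ/2`; entropy from `SecondLawInProbability` verbatim).
* `stub_relEntropyReadout` (S3, the deterministic core in dock coordinates, M):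
  `RelEntropyStability →` there is `ηd > 0` (`:= η₀^conv/2`, `η₀^conv` from
  `HsEntropyUniformlyConvex`) such that for every classical solution in the band `ρσ³ < ηd`,
  every `t < T`, `lam > 0`, `Cexp`, `c₁ > 0` and `ε > 0` there is `δ > 0` with: every good field
  with initial relative entropy `≤ δ` is `ε`-close in `L¹ₓ` to `U_cl` at time `t` (restriction of
  the classical solution to `[0, (t+T)/2]`, density floor `min(c₁, min ρ_cl) > 0` on that compact
  slab, EOS hypotheses of `RelEntropyStability` from `HsEntropyUniformlyConvex` /
  `HsFreeEnergyConvex`, time-clamping of `U` outside `[0,t]`).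
* `stub_blocksToFields` (S4, smearing, M): if the `L¹ₓ` block deviation at time `t` tends to `0`
  in probability then `TendstoHydroFieldsAt … t` (`∫χ d(field) = ∫(χ∗φ̌_N)·(block field)` exactly
  by Fubini and kernel mass `1`, `χ∗φ̌_N → χ` uniformly, total kinetic energy `≤ ∫E_cl(t) + 1` on
  `{l1Dev ≤ 1}`).

`EulerRelEntropyDock_of` (sorry-free, pure logic + one union bound): `η₀ := min ηi (min ηg ηd)`,
`σ₀ := min σ₁ σ₂`; at `t = 0` the conclusion is the hypothesis; for `0 < t < T` take the kernel
family at `γ = 1/15` (S0), reduce the conclusion to block convergence at `t` (S4); for `ε > 0`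
take `(lam, Cexp, c₁)` from S2 and `δ` from S3; the event `{ε < l1Dev(t)}` is contained in
`{not a good field} ∪ {δ < initRelEnt}` (contrapositive of S3), whose probabilities tend to `0`
by S2 and S1.

Disproof used: none relevant — `ledger crux ls stmt-AtomisticToContinuum-17823` has no workfiles
at birth (no `Disproof.lean`, no `Negative/` lemma, no `_false_without_` theorem, no dead line);
`ledger negatives --problem AtomisticToContinuum`: no statement of the dock's shape.
-/

noncomputable section

namespace Summit.AtomisticToContinuum.HydrodynamicLimit.Cruxes.EulerRelEntropyDock.Birth

open scoped BigOperators Topology ENNReal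
open Filter Set MeasureTheory
open Literature.MathematicalPhysics.KineticTheory Literature.Analysis.FluidPDE
open Summit.AtomisticToContinuum.HydrodynamicLimit.Theses.StiffCollisionalRelaxation

/-! ## Types (the crux's) -/

/-- Phase space of `N + 1` spheres on `𝕋³`. -/
abbrev Cfg (N : ℕ) : Type := Config (N + 1) (Fin 3) T3

/-- A hard-sphere flow of `N + 1` spheres of diameter `hsDiameter σ N = σ (N+1)^{-1/3}` on `𝕋³`. -/
abbrev Flow (σ : ℝ) (N : ℕ) : Type :=
  HardSphereFlow (Torus.geometry (Fin 3)) (hsDiameter σ N) (N + 1)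

/-- Families of flows (the conjunct's `Φ`). -/
abbrev Flows (σ : ℝ) : Type := (N : ℕ) → Flow σ N

/-- Conserved state vectors `U = (ρ, m, E)` (the value type of the fields of `RelEntropyStability`). -/
abbrev St : Type := ℝ × V3 × ℝ

/-! ## Admissible kernel families — VERBATIM the six clauses quantified over in
`FastMomentRelaxation` / `CollisionalTransferLocality` / `AprioriBoundsInBand` (ii) /
`SecondLawInProbability` (smooth, `≥ 0`, mass `1`, support radius `(N+1)^{-γ}`,
`sup ≤ C (N+1)^{3γ}`, `‖∇‖ ≤ C (N+1)^{4γ}`) -/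

/-- `φ : ℕ → 𝕋³ → ℝ` is an admissible kernel family at mesoscopic exponent `γ` with constant `C`. -/
def Admissible (γ C : ℝ) (φ : ℕ → T3 → ℝ) : Prop :=
  (∀ N, Literature.Analysis.FunctionSpaces.Torus.IsSmooth (φ N)) ∧ (∀ N y, 0 ≤ φ N y) ∧
    (∀ N, ∫ y, φ N y = 1) ∧
    (∀ (N : ℕ) y, ((N : ℝ) + 1) ^ (-γ) ≤ Torus.euclidDist y 0 → φ N y = 0) ∧
    (∀ (N : ℕ) y, φ N y ≤ C * ((N : ℝ) + 1) ^ (3 * γ)) ∧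
    (∀ (N : ℕ) y, ‖Literature.Analysis.FunctionSpaces.Torus.gradient (φ N) y‖ ≤
      C * ((N : ℝ) + 1) ^ (4 * γ))

/-! ## Block fields — VERBATIM the kernel averages `ρb`, `mb`, `Eb` of the cruxes -/

/-- Block density `ρ̄(x) = ⟨μ_z, φ_N(· − x)⟩`. -/
def bρ (φ : ℕ → T3 → ℝ) (N : ℕ) (z : Cfg N) (x : T3) : ℝ :=
  empiricalDensityField z (fun y => φ N (y - x))

/-- Block momentum `m̄(x) = ⟨μ_z, φ_N(· − x) v⟩`. -/
def bm (φ : ℕ → T3 → ℝ) (N : ℕ) (z : Cfg N) (x : T3) : V3 :=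
  empiricalMomentumField z (fun y => φ N (y - x))

/-- Block kinetic energy `Ē(x) = ⟨μ_z, φ_N(· − x) |v|²/2⟩`. -/
def bE (φ : ℕ → T3 → ℝ) (N : ℕ) (z : Cfg N) (x : T3) : ℝ :=
  empiricalEnergyField z (fun y => φ N (y - x))

/-- The block state vector `Ū(x) = (ρ̄, m̄, Ē)(x)` of a configuration. -/
def bU (φ : ℕ → T3 → ℝ) (N : ℕ) (z : Cfg N) (x : T3) : St :=
  (bρ φ N z x, bm φ N z x, bE φ N z x)

/-- The block field `(s, x) ↦ Ū_N(s, x)` ALONG THE TRAJECTORY of the datum `z` under the flow `Ψ`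
(the field `U` at which the hypotheses of `RelEntropyStability` are instantiated). -/
def Ufl (φ : ℕ → T3 → ℝ) {σ : ℝ} {N : ℕ} (Ψ : Flow σ N) (z : Cfg N) : ℝ → T3 → St :=
  fun s x => bU φ N (Ψ.flow s z) x

/-! ## The objects of `RelEntropyStability` — VERBATIM its `let`-bound `ησ`, `Ucl`, `Λ`, `Fl` -/

/-- The mathematical entropy `η_σ(ρ, m, E) = −ρ(3/2 log θ − log ρ − f_ex(ρσ³))`,
`θ = (2/3)(E/ρ − |m|²/(2ρ²))` (the `ησ` of `RelEntropyStability` / `SecondLawInProbability`). -/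
def eta (σ : ℝ) (U : St) : ℝ :=
  -(U.1 * (3 / 2 * Real.log (2 / 3 * (U.2.2 / U.1 - ‖U.2.1‖ ^ 2 / (2 * U.1 ^ 2))) - Real.log U.1 -
    hsExcessFreeEnergy (U.1 * σ ^ 3)))

/-- The conserved fields `U_cl = (ρ, ρu, E)` of a classical solution (the `Ucl` of
`RelEntropyStability`). -/
def Ucl (ρ θ : ℝ → T3 → ℝ) (u : ℝ → T3 → V3) (s : ℝ) (x : T3) : St :=
  (ρ s x, ρ s x • u s x, totalEnergyDensity (ρ s x) (u s x) (θ s x))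

/-- The entropy variables `Λ(s, x) = Dη_σ(U_cl(s, x))` (the `Λ` of `RelEntropyStability`). -/
def Lam (σ : ℝ) (ρ θ : ℝ → T3 → ℝ) (u : ℝ → T3 → V3) (s : ℝ) (x : T3) : St →L[ℝ] ℝ :=
  fderiv ℝ (eta σ) (Ucl ρ θ u s x)

/-- The hard-sphere Euler fluxes `F_j(U)` in conserved variables (the `Fl` of
`RelEntropyStability`). -/
def Fl (σ : ℝ) (j : Fin 3) (U : St) : St :=
  (U.2.1 j,
    (U.2.1 j / U.1) • U.2.1 +
      hsPressure σ U.1 (2 / 3 * (U.2.2 / U.1 - ‖U.2.1‖ ^ 2 / (2 * U.1 ^ 2))) •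
        EuclideanSpace.single j (1 : ℝ),
    (U.2.2 + hsPressure σ U.1 (2 / 3 * (U.2.2 / U.1 - ‖U.2.1‖ ^ 2 / (2 * U.1 ^ 2)))) * U.2.1 j / U.1)

/-! ## The hypotheses (a)–(h) and the conclusion of `RelEntropyStability`, as predicates of a
general field `U : ℝ → 𝕋³ → ℝ × V3 × ℝ` -/

/-- (a)–(c) REGULARITY on `[0, t]`: jointly measurable, bounded and `x`-continuous on the slab
(`RelEntropyStability` asks (b), (c) for all `s`; the readout stub clamps time to `[0, t]`). -/
def FieldRegular (t : ℝ) (U : ℝ → T3 → St) : Prop :=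
  Measurable (Function.uncurry U) ∧ (∃ B : ℝ, ∀ s ∈ Icc 0 t, ∀ x, ‖U s x‖ ≤ B) ∧
    ∀ s ∈ Icc 0 t, Continuous (U s)

/-- (d) CHAMBER on `[0, t]`: `c₁ ≤ ρ`, `ρσ³ ≤ 1`, `|m|² < 2ρE` (verbatim). -/
def InChamber (σ c₁ t : ℝ) (U : ℝ → T3 → St) : Prop :=
  ∀ s ∈ Icc 0 t, ∀ x, c₁ ≤ (U s x).1 ∧ (U s x).1 * σ ^ 3 ≤ 1 ∧
    ‖(U s x).2.1‖ ^ 2 < 2 * (U s x).1 * (U s x).2.2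

/-- (e) the INITIAL RELATIVE ENTROPY `∫ (η_σ(U₀) − η_σ(U_cl,0) − Λ₀ (U₀ − U_cl,0)) dx` (verbatim). -/
def initRelEnt (σ : ℝ) (ρ θ : ℝ → T3 → ℝ) (u : ℝ → T3 → V3) (U : ℝ → T3 → St) : ℝ :=
  ∫ x, (eta σ (U 0 x) - eta σ (Ucl ρ θ u 0 x) - Lam σ ρ θ u 0 x (U 0 x - Ucl ρ θ u 0 x))

/-- (f) the approximate GLOBAL ENTROPY INEQUALITY `∫η_σ(U(τ)) ≤ ∫η_σ(U(0)) + δ`, `τ ≤ t`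
(verbatim; the complement of the event of `SecondLawInProbability`). -/
def EntropyIneq (σ t δ : ℝ) (U : ℝ → T3 → St) : Prop :=
  ∀ τ ∈ Icc 0 t, (∫ x, eta σ (U τ x)) ≤ (∫ x, eta σ (U 0 x)) + δ

/-- (g) the HOT-CELL FUNCTIONAL bound `∫₀ᵗ∫ 1(E > Mρ)(E^{3/2}ρ^{-1/2} + E + ρ) ≤ Cexp e^{−lam M}`
for all `M ≥ 1` (verbatim). -/
def HotCellBound (t lam Cexp : ℝ) (U : ℝ → T3 → St) : Prop :=
  ∀ M : ℝ, 1 ≤ M →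
    (∫ s in Icc 0 t, ∫ x, (if M * (U s x).1 < (U s x).2.2 then
        (U s x).2.2 ^ (3 / 2 : ℝ) / Real.sqrt ((U s x).1) + (U s x).2.2 + (U s x).1 else 0)) ≤
      Cexp * Real.exp (-(lam * M))

/-- (h) the WEAK RESIDUAL against `Λ = Dη_σ(U_cl)` with the hs-Euler fluxes is `≤ δ`, `τ ≤ t`
(verbatim). -/
def WeakResidualSmall (σ : ℝ) (ρ θ : ℝ → T3 → ℝ) (u : ℝ → T3 → V3) (t δ : ℝ)
    (U : ℝ → T3 → St) : Prop :=
  ∀ τ ∈ Icc 0 t,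
    |(∫ x, Lam σ ρ θ u τ x (U τ x)) - (∫ x, Lam σ ρ θ u 0 x (U 0 x)) -
        ∫ s in Icc 0 τ, ∫ x,
          (Literature.Analysis.FunctionSpaces.Torus.timeDeriv (Lam σ ρ θ u) s x (U s x) +
            ∑ j, Literature.Analysis.FunctionSpaces.Torus.partialDeriv j (Lam σ ρ θ u s) x
              (Fl σ j (U s x)))| ≤ δ

/-- The conclusion: `L¹ₓ` DEVIATION of `U(τ)` from `U_cl(τ) = (ρ, ρu, E)(τ)` (verbatim). -/
def l1Dev (ρ θ : ℝ → T3 → ℝ) (u : ℝ → T3 → V3) (τ : ℝ) (U : ℝ → T3 → St) : ℝ :=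
  ∫ x, (|(U τ x).1 - ρ τ x| + ‖(U τ x).2.1 - ρ τ x • u τ x‖ +
    |(U τ x).2.2 - totalEnergyDensity (ρ τ x) (u τ x) (θ τ x)|)

/-- A GOOD FIELD at `(σ, solution, t, lam, Cexp, c₁, δ)`: hypotheses (a)–(d), (f)–(h) of
`RelEntropyStability` (everything except the initial relative entropy (e), which is a `t = 0`
statics matter). -/
def GoodField (σ : ℝ) (ρ θ : ℝ → T3 → ℝ) (u : ℝ → T3 → V3) (t lam Cexp c₁ δ : ℝ)
    (U : ℝ → T3 → St) : Prop :=
  FieldRegular t U ∧ InChamber σ c₁ t U ∧ EntropyIneq σ t δ U ∧ HotCellBound t lam Cexp U ∧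
    WeakResidualSmall σ ρ θ u t δ U

/-! ## The five registered stubs -/

/-- **S0 — ADMISSIBLE KERNEL FAMILIES EXIST** (construction; size S–M). By name the route's support
item `AdmissibleKernelsExist` (stmt-AtomisticToContinuum-18068): for every `γ ∈ (0, 1/15]` a
smooth, nonnegative, mass-one kernel family supported in the ball of radius `(N+1)^{-γ}` with
`sup ≤ C(N+1)^{3γ}`, `‖∇‖ ≤ C(N+1)^{4γ}` (and even) exists. ROLE: the dock must instantiate the
`∀`-kernel cruxes with one family (`γ = 1/15` below); without it they are consumed vacuously.
Why plausibly true: smooth radial bump of radius `min((N+1)^{-γ}, 1/4)` periodised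
(`Torus.isSmooth_periodize` / `b ∘ reprSym`). Sources: Spohn1991 Part I Ch. 3; tree
`Literature.Analysis.FluidPDE.DuchonRobertLocalBalance` (mollifier kernels). -/
theorem stub_admissibleKernels : AdmissibleKernelsExist := by
  sorry

/-- **S1 — INITIAL RELATIVE ENTROPY IS SMALL IN PROBABILITY** (statics at `t = 0`; size M;
obligation G1 of the 11094 verdict). There is a packing threshold `ηi > 0`, fixed BEFORE the
profiles, such that for continuous positive profiles there is `σ₀ > 0` with: for `0 < σ < σ₀`,
every classical hs-Euler solution on `[0, T)`, `T > 0`, in the band `ρσ³ < ηi`, whose `t = 0`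
fields are the LLN limit of the local Gibbs laws, every admissible kernel family and every
`δ > 0`, the local-Gibbs probability that the initial relative entropy
`∫ (η_σ(Ū_N(0,x)) − η_σ(U_cl(0,x)) − Dη_σ(U_cl(0,x))(Ū_N(0,x) − U_cl(0,x))) dx` of the block
field exceeds `δ` tends to `0`.
Why plausibly true: at `t = 0` a block of radius `(N+1)^{-γ}` holds `≍ (N+1)^{1−3γ} ≥ (N+1)^{4/5}`
spheres, so under the (low-activity, Gaussian-velocity) local Gibbs law the block fields converge
to `(ρ₀, ρ₀u₀, E₀)` UNIFORMLY in `x` in probability (speed-`N^{4/5}` concentration against an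
`N^{3γ}`-net); the LLN hypothesis identifies `(ρ₀, ρ₀u₀, E₀) = U_cl(0)` (weak limits unique,
both sides continuous; local Gibbs laws are probability measures — `MesoscopicLLN`); `U_cl(0)`
lies in the interior of the region where `η_σ` is `C²` (`ρ(0) ≥ min > 0`, `θ(0) ≥ min > 0`,
`f_ex` analytic below `ηi ≤ r_an` — landed `HsEosLowDensity`), where
`h(U|Ū) ≤ C|U − Ū|²`; no cold block at `t = 0` (`TimeZeroThermalFloor`). Why it might fail: only
through the junk conventions (`log 0 = 0`, `x/0 = 0`) on empty blocks, excluded w.h.p. by the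
`t = 0` density floor. Sources: Spohn1991 Part I Ch. 3 §3.1–3.2, Ruelle1969 §3.4,
LebowitzPenrose1964, KipnisLandim1999 App. 1; route supports `MesoscopicLLN` (9524),
`TimeZeroThermalFloor` (17750). -/
theorem stub_initialRelEntropy :
    ∃ ηi : ℝ, 0 < ηi ∧
      ∀ (a₀ θ₀ : T3 → ℝ) (u₀ : T3 → V3), Continuous a₀ → Continuous θ₀ → Continuous u₀ →
        (∀ x, 0 < a₀ x) → (∀ x, 0 < θ₀ x) →
        ∃ σ₀ : ℝ, 0 < σ₀ ∧ ∀ σ : ℝ, 0 < σ → σ < σ₀ →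
          ∀ (T : ℝ) (ρ θ : ℝ → T3 → ℝ) (u : ℝ → T3 → V3), IsHardSphereEulerSolution σ T ρ u θ →
            0 < T → (∀ s ∈ Ico 0 T, ∀ x, ρ s x * σ ^ 3 < ηi) →
            ∀ Φ : Flows σ,
              TendstoHydroFieldsAt (fun N => localGibbsLaw σ a₀ u₀ θ₀ N (Φ N)) Φ ρ u θ 0 →
                ∀ (γ C : ℝ) (φ : ℕ → T3 → ℝ), 0 < γ → γ ≤ 1 / 15 → Admissible γ C φ →
                  ∀ δ : ℝ, 0 < δ →
                    Tendsto (fun N : ℕ => localGibbsLaw σ a₀ u₀ θ₀ N (Φ N)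
                      {z | δ < initRelEnt σ ρ θ u (Ufl φ (Φ N) z)}) atTop (𝓝 0) := by
  sorry

/-- **S2 — THE GOOD EVENT IS LIKELY** (the probabilistic glue ALONG THE FLOW; THE LOAD-BEARING
STUB; size L). From the four in-probability antecedents of the dock there is a guard threshold
`ηg > 0`, fixed BEFORE the profiles, such that for continuous positive profiles there is `σ₀ > 0`
with: for `0 < σ < σ₀`, every classical hs-Euler solution on `[0, T)` in the band `ρσ³ < ηg`,
every flow family with the `t = 0` LLN, every `0 < t < T` and every admissible kernel family
(`γ ≤ 1/15`) there are `lam > 0`, `Cexp`, `c₁ > 0` such that for every `δ > 0` the local-Gibbs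
probability that the trajectory block field is NOT a good field at `(t, lam, Cexp, c₁, δ)` tends
to `0`.
Proof plan: `ηg := min(η₁/2, r_an/2)` (`η₁` from `AprioriBoundsInBand`, so the guard gives its
dilute premise `2ρσ³ < η₁` on `[0,t]`; `r_an` the analyticity radius of `hsExcessFreeEnergy`,
landed `hsEosLowDensity_proof`, so that `Λ = Dη_σ(U_cl)` is a SMOOTH space–time test on `[0,t]`,
`U_cl` being smooth with `ρ, θ > 0`); `σ₀ := min` of the four antecedents' thresholds. On the
intersection of the good events: (d) chamber `c₁ ≤ ρ̄`, `ρ̄σ³ ≤ 1` from `AprioriBoundsInBand` (ii)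
verbatim, strictness `‖m̄‖² < 2ρ̄Ē` = Cauchy–Schwarz with equality only for equal velocities in a
non-empty block (a null event along the flow); (f) `SecondLawInProbability` verbatim; (g) from the
exponential moment (i): on `{Ē > Mρ̄}`, `Ē ≤ M e^{−λM}⟨φ e^{λ|v|²}⟩` (`M ≥ 1/λ`) and
`Ē^{3/2}ρ̄^{−1/2} ≤ 2^{−3/2}⟨φ|v|³⟩ ≤ 2M^{3/2}e^{−λM}⟨φ e^{λ|v|²}⟩` (`M ≥ 3/(2λ)`), integrated with
`∫ₓ⟨φ(·−x) e^{λ|v|²}⟩ = ⟨μ, e^{λ|v|²}⟩`, so `lam := λ/2`; (h) the weak residual against `Λ` splits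
EXACTLY (Irving–Kirkwood balance along `HardSphereFlow.isTrajectory`) into the kinetic defects
`∂Λ_m : D + ∂Λ_E · (Dū + q)` — small by `FastMomentRelaxation` in `L²ₜ,ₓ` and
`∫∫|ū|² ≤ 2tE_tot/c₁` on the chamber event — plus the two collisional residuals of
`CollisionalTransferLocality` with `ψ = Λ_m`, `χ = Λ_E`; (a)–(c) hold on `Ψ.good` (smooth kernel,
finitely many collisions on `[0,t]`, right-continuous flow), `localGibbsLaw (goodᶜ) = 0`; finite
unions. Why it might fail: pairing the FIXED test `Λ` with block fields produces the
`N`-dependent tests `Λ ∗ φ̌_N` (`→ Λ` in `C¹`), while the antecedents are stated per fixed test —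
absorbing the difference needs an a-priori bound on the tested collisional transfer, linear in
`‖ψ‖_{C¹}` (virial / collision count), that no antecedent states (rreview-0815T13-26); and the
strict inequality `‖m̄‖² < 2ρ̄Ē` must hold for ALL `s ≤ t`, `x` simultaneously. Both are
producer/consumer interface points, repaired by restating the pair, not kills. Sources:
Dafermos2005 Thm 5.2.1 + (5.2.14), Spohn1991 Part I §3.2–3.3 (3.6)–(3.8), IrvingKirkwood1950,
KipnisLandim1999 Ch. 6, OllaVaradhanYau1993 §3. -/
theorem stub_goodEventLikely :
    FastMomentRelaxation → CollisionalTransferLocality → AprioriBoundsInBand →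
      SecondLawInProbability →
      ∃ ηg : ℝ, 0 < ηg ∧
        ∀ (a₀ θ₀ : T3 → ℝ) (u₀ : T3 → V3), Continuous a₀ → Continuous θ₀ → Continuous u₀ →
          (∀ x, 0 < a₀ x) → (∀ x, 0 < θ₀ x) →
          ∃ σ₀ : ℝ, 0 < σ₀ ∧ ∀ σ : ℝ, 0 < σ → σ < σ₀ →
            ∀ (T : ℝ) (ρ θ : ℝ → T3 → ℝ) (u : ℝ → T3 → V3), IsHardSphereEulerSolution σ T ρ u θ →
              (∀ s ∈ Ico 0 T, ∀ x, ρ s x * σ ^ 3 < ηg) →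
              ∀ Φ : Flows σ,
                TendstoHydroFieldsAt (fun N => localGibbsLaw σ a₀ u₀ θ₀ N (Φ N)) Φ ρ u θ 0 →
                  ∀ t ∈ Ico 0 T, 0 < t →
                    ∀ (γ C : ℝ) (φ : ℕ → T3 → ℝ), 0 < γ → γ ≤ 1 / 15 → Admissible γ C φ →
                      ∃ lam : ℝ, 0 < lam ∧ ∃ Cexp c₁ : ℝ, 0 < c₁ ∧ ∀ δ : ℝ, 0 < δ →
                        Tendsto (fun N : ℕ => localGibbsLaw σ a₀ u₀ θ₀ N (Φ N)
                          {z | ¬ GoodField σ ρ θ u t lam Cexp c₁ δ (Ufl φ (Φ N) z)})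
                          atTop (𝓝 0) := by
  sorry

/-- **S3 — DETERMINISTIC READOUT IN DOCK COORDINATES** (size M). From `RelEntropyStability` there
is an EOS chamber threshold `ηd > 0` such that for every `σ > 0`, every classical hs-Euler
solution on `[0, T)` in the band `ρσ³ < ηd`, every `t < T`, `lam > 0`, `Cexp`, `c₁ > 0` and
`ε > 0` there is `δ > 0` with: every field that is good at `(t, lam, Cexp, c₁, δ)` and has initial
relative entropy `≤ δ` is `ε`-close to `U_cl(t)` in `L¹ₓ`.
Proof plan: `ηd := η₀^conv / 2` with `η₀^conv` from the support `HsEntropyUniformlyConvex`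
(`f_ex` `C²` on `(0, η₀^conv)`, strong convexity on every chamber) and the big-region convexity
from `HsFreeEnergyConvex` (both LEMMAS of the dock; 9525/9526); restrict the solution to
`[0, T′)`, `T′ := (t + T)/2` (`IsSmoothSpaceTimeOn` is monotone in the time set and
`timeDerivWithin (Ico 0 T′) = timeDerivWithin (Ico 0 T)` on `Ico 0 T′`), so that
`c₁′ := min(c₁, min_{[0,T′]×𝕋³} ρ) > 0` (compactness, `density_pos`, continuity) is a density
floor on the whole life of the restricted solution and `2ρσ³ < 2ηd = η₀^conv` its chamber; apply
`RelEntropyStability` at `(σ, η₀^conv, c₁′, lam, Cexp)`, `t₁ := t ∈ Ico 0 T′`, to the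
time-CLAMPED field `s ↦ U(max 0 (min s t))` (bounded and `x`-continuous for all `s`, measurable,
equal to `U` on `[0, t]`; hypotheses (d)–(h) only see `[0, t]`), and read the conclusion at
`τ = t`. Why it might fail: no mathematical obstruction beyond the truth of the two statics
supports; the restriction lemma for `IsHardSphereEulerSolution` is unfiled bookkeeping. Sources:
Dafermos2005 Thm 5.2.1, Ruelle1969 Thm 3.4.4, route supports `HsEntropyUniformlyConvex`,
`HsFreeEnergyConvex`, landed `Theorems.ImplosionDichotomyHsEosLowDensity`. -/
theorem stub_relEntropyReadout :
    RelEntropyStability →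
      ∃ ηd : ℝ, 0 < ηd ∧ ∀ σ : ℝ, 0 < σ →
        ∀ (T : ℝ) (ρ θ : ℝ → T3 → ℝ) (u : ℝ → T3 → V3), IsHardSphereEulerSolution σ T ρ u θ →
          (∀ s ∈ Ico 0 T, ∀ x, ρ s x * σ ^ 3 < ηd) →
          ∀ t ∈ Ico 0 T, ∀ lam : ℝ, 0 < lam → ∀ (Cexp c₁ : ℝ), 0 < c₁ → ∀ ε : ℝ, 0 < ε →
            ∃ δ : ℝ, 0 < δ ∧ ∀ U : ℝ → T3 → St,
              GoodField σ ρ θ u t lam Cexp c₁ δ U → initRelEnt σ ρ θ u U ≤ δ →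
                l1Dev ρ θ u t U ≤ ε := by
  sorry

/-- **S4 — FROM BLOCKS TO TESTED FIELDS** (smearing; size M). If at a time `t < T` the `L¹ₓ`
block deviation of the trajectory block field (admissible kernel family) from the classical
solution tends to `0` in probability under the laws `localGibbsLaw σ a₀ u₀ θ₀ N (Φ N)`, then the
raw empirical density / momentum / energy fields at time `t` tested against every continuous `χ`
converge in probability to `∫χρ(t)`, `∫χρu(t)`, `∫χE(t)`, i.e. `TendstoHydroFieldsAt … t`.
Proof plan: `∫ₓ χ(x) ρ̄(t,x) dx = ⟨μ_N, χ ∗ φ̌_N⟩` EXACTLY (Fubini for the finite empirical sum,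
kernel mass `1`), `‖χ ∗ φ̌_N − χ‖_∞ ≤ ω_χ((N+1)^{-γ})` (uniform continuity on the compact torus,
`φ_N ≥ 0`, support radius `(N+1)^{-γ}`), `⟨μ_N, 1⟩ = 1` (`empiricalDensityField_one`); for momentum
and energy the same with the total kinetic energy, which is `∫ₓĒ(t,x)dx ≤ ∫E_cl(t) + 1` on
`{l1Dev(t) ≤ 1}`, and `2|v| ≤ 1 + |v|²`; finally `|∫χ(ρ̄ − ρ_cl)(t)| ≤ ‖χ‖_∞ · l1Dev(t)`. Why it
might fail: no obstruction (`(ρ, u, θ)(t)` continuous for `t < T`, so the targets are finite).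
Sources: Spohn1991 Part I §3.1, OllaVaradhanYau1993 §1. -/
theorem stub_blocksToFields :
    ∀ σ : ℝ, 0 < σ → ∀ (a₀ θ₀ : T3 → ℝ) (u₀ : T3 → V3) (T : ℝ) (ρ θ : ℝ → T3 → ℝ)
      (u : ℝ → T3 → V3), IsHardSphereEulerSolution σ T ρ u θ → ∀ Φ : Flows σ, ∀ t ∈ Ico 0 T,
        ∀ (γ C : ℝ) (φ : ℕ → T3 → ℝ), 0 < γ → γ ≤ 1 / 15 → Admissible γ C φ →
          (∀ ε : ℝ, 0 < ε →
            Tendsto (fun N : ℕ => localGibbsLaw σ a₀ u₀ θ₀ N (Φ N)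
              {z | ε < l1Dev ρ θ u t (Ufl φ (Φ N) z)}) atTop (𝓝 0)) →
          TendstoHydroFieldsAt (fun N => localGibbsLaw σ a₀ u₀ θ₀ N (Φ N)) Φ ρ u θ t := by
  sorry

/-! ## The stub STATEMENTS under the stubs' own registered names (hypotheses of
`EulerRelEntropyDock_of`)

The layer-invariant audit admits, as hypotheses of the theorem concluding the crux, only registered
obligations BY NAME; `Statement.stub_x := type_of% stub_x` is the statement of the registered stub
`stub_x` under the same short name (D-0027 §3.3 shape). -/

namespace Statement

/-- Statement of S0 `stub_admissibleKernels`. -/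
abbrev stub_admissibleKernels : Prop := type_of% Birth.stub_admissibleKernels
/-- Statement of S1 `stub_initialRelEntropy`. -/
abbrev stub_initialRelEntropy : Prop := type_of% Birth.stub_initialRelEntropy
/-- Statement of S2 `stub_goodEventLikely`. -/
abbrev stub_goodEventLikely : Prop := type_of% Birth.stub_goodEventLikely
/-- Statement of S3 `stub_relEntropyReadout`. -/
abbrev stub_relEntropyReadout : Prop := type_of% Birth.stub_relEntropyReadout
/-- Statement of S4 `stub_blocksToFields`. -/
abbrev stub_blocksToFields : Prop := type_of% Birth.stub_blocksToFields

end Statement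

/-! ## Composition (sorry-free): the five stubs ⟹ the crux BY NAME -/

/-- **The skeleton theorem.** `η₀ := min ηi (min ηg ηd)` (the thresholds of S1, S2, S3 — all fixed
before the profiles, as the guarded conjunct demands), `σ₀ := min σ₁ σ₂`. Given the five
antecedents of the dock, the Statement's guard `ρσ³ < η₀`, the `t = 0` LLN and `t ∈ Ico 0 T`: at
`t = 0` the conclusion is the hypothesis; for `0 < t`, S0 supplies an admissible kernel family at
`γ = 1/15`, S4 reduces the conclusion to block convergence at `t`; for `ε > 0`, S2 supplies
`(lam, Cexp, c₁)` and S3 supplies `δ`; the event `{ε < l1Dev(t)}` lies in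
`{not a good field} ∪ {δ < initRelEnt}` (contrapositive of S3), and the two probabilities tend to
`0` by S2 (fed with `FastMomentRelaxation`, `CollisionalTransferLocality`, `AprioriBoundsInBand`,
`SecondLawInProbability`) and S1. `RelEntropyStability` is consumed by S3. -/
theorem EulerRelEntropyDock_of (hK : Statement.stub_admissibleKernels)
    (hI : Statement.stub_initialRelEntropy) (hG : Statement.stub_goodEventLikely)
    (hD : Statement.stub_relEntropyReadout) (hS : Statement.stub_blocksToFields) :
    Summit.AtomisticToContinuum.HydrodynamicLimit.Theses.StiffCollisionalRelaxation.EulerRelEntropyDock := by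
  intro hF hC hA hR hL
  obtain ⟨ηi, hηi, HI⟩ := (hI : type_of% Birth.stub_initialRelEntropy)
  obtain ⟨ηg, hηg, HG⟩ := (hG : type_of% Birth.stub_goodEventLikely) hF hC hA hL
  obtain ⟨ηd, hηd, HD⟩ := (hD : type_of% Birth.stub_relEntropyReadout) hR
  have hη : 0 < min ηi (min ηg ηd) := lt_min hηi (lt_min hηg hηd)
  refine ⟨min ηi (min ηg ηd), hη, ?_⟩
  intro a₀ θ₀ u₀ ha hθ hu ha0 hθ0
  obtain ⟨σ₁, hσ₁, HI'⟩ := HI a₀ θ₀ u₀ ha hθ hu ha0 hθ0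
  obtain ⟨σ₂, hσ₂, HG'⟩ := HG a₀ θ₀ u₀ ha hθ hu ha0 hθ0
  refine ⟨min σ₁ σ₂, lt_min hσ₁ hσ₂, ?_⟩
  intro σ hσ hσlt T ρ θ u hsol hguard Φ h0 t ht
  have hσ1 : σ < σ₁ := lt_of_lt_of_le hσlt (min_le_left _ _)
  have hσ2 : σ < σ₂ := lt_of_lt_of_le hσlt (min_le_right _ _)
  have hgi : ∀ s ∈ Ico 0 T, ∀ x, ρ s x * σ ^ 3 < ηi := fun s hs x =>
    lt_of_lt_of_le (hguard s hs x) (min_le_left _ _)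
  have hgg : ∀ s ∈ Ico 0 T, ∀ x, ρ s x * σ ^ 3 < ηg := fun s hs x =>
    lt_of_lt_of_le (hguard s hs x) ((min_le_right _ _).trans (min_le_left _ _))
  have hgd : ∀ s ∈ Ico 0 T, ∀ x, ρ s x * σ ^ 3 < ηd := fun s hs x =>
    lt_of_lt_of_le (hguard s hs x) ((min_le_right _ _).trans (min_le_right _ _))
  have hT : 0 < T := lt_of_le_of_lt ht.1 ht.2
  -- at `t = 0` the conclusion is the `t = 0` hypothesis itself
  rcases eq_or_lt_of_le ht.1 with h0t | htpos
  · subst h0t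
    exact h0
  -- an admissible kernel family at `γ = 1/15` (S0)
  obtain ⟨C, φ, h1, h2, h3, h4, h5, h6, -⟩ :=
    (hK : type_of% Birth.stub_admissibleKernels) (1 / 15) (by norm_num) le_rfl
  have hφ : Admissible (1 / 15) C φ := ⟨h1, h2, h3, h4, h5, h6⟩
  -- smearing (S4): it suffices to show block convergence at `t`
  refine (hS : type_of% Birth.stub_blocksToFields) σ hσ a₀ θ₀ u₀ T ρ θ u hsol Φ t ht (1 / 15) C φ
    (by norm_num) le_rfl hφ ?_
  intro ε hε
  -- the glue constants (S2) and the readout threshold (S3)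
  obtain ⟨lam, hlam, Cexp, c₁, hc₁, HG''⟩ :=
    HG' σ hσ hσ2 T ρ θ u hsol hgg Φ h0 t ht htpos (1 / 15) C φ (by norm_num) le_rfl hφ
  obtain ⟨δ, hδ, Himp⟩ := HD σ hσ T ρ θ u hsol hgd t ht lam hlam Cexp c₁ hc₁ ε hε
  -- the two bad events
  have hA' := HG'' δ hδ
  have hB' := HI' σ hσ hσ1 T ρ θ u hsol hT hgi Φ h0 (1 / 15) C φ (by norm_num) le_rfl hφ δ hδ
  have hsum : Tendsto (fun N : ℕ =>
      localGibbsLaw σ a₀ u₀ θ₀ N (Φ N)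
          {z | ¬ GoodField σ ρ θ u t lam Cexp c₁ δ (Ufl φ (Φ N) z)} +
        localGibbsLaw σ a₀ u₀ θ₀ N (Φ N) {z | δ < initRelEnt σ ρ θ u (Ufl φ (Φ N) z)})
      atTop (𝓝 0) := by
    simpa using hA'.add hB'
  refine tendsto_of_tendsto_of_tendsto_of_le_of_le' tendsto_const_nhds hsum
    (Eventually.of_forall fun _ => zero_le) (Eventually.of_forall fun N => ?_)
  refine (measure_mono ?_).trans (measure_union_le _ _)
  intro z hz
  by_contra hcon
  simp only [Set.mem_union, Set.mem_setOf_eq, not_or, not_not, not_lt] at hcon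
  obtain ⟨hgood, hinit⟩ := hcon
  exact absurd (Himp _ hgood hinit) (not_le.mpr hz)

end Summit.AtomisticToContinuum.HydrodynamicLimit.Cruxes.EulerRelEntropyDock.Birth

end
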